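import Summits.ResolutionOfSingularities.ResolutionOfSingularities.Theorems.FrobeniusClosingSteerContentFrameLocAtCentre
import Summits.ResolutionOfSingularities.ResolutionOfSingularities.Theorems.FrobeniusClosingSteerLogExitToroidal
import Summits.ResolutionOfSingularities.ResolutionOfSingularities.Theorems.FrobeniusClosingSteerIntegralClosureModel
import Summits.ResolutionOfSingularities.ResolutionOfSingularities.Theorems.FrobeniusClosingSteerSandwichModel
import Summits.ResolutionOfSingularities.ResolutionOfSingularities.Theorems.FrobeniusClosingSteerConstantsPthPowers
import Summits.ResolutionOfSingularities.ResolutionOfSingularities.Theorems.ValuativeLuAlphaPTorsorChartRegular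
import Literature.RingTheory.Derivation.IteratedSliceDecomposition
import Literature.FieldTheory.Separability.PDegreeSeparablyGenerated
import Literature.AlgebraicGeometry.Resolution.AffineDomainEquidim
import HarnessLib

/-!
# Crux `Steer` (stmt-ResolutionOfSingularities-16345), chain W4.1 — the registered stub
# `stub_logFinalExitM` (r18/r19): **`∀ p, LogFinalExitM p`**, the log-final exit in MODEL form (LEAF)

OURS (campaign `res-hironaka`, rung L, slot W4.1, chain W4.1; seat res-D-pv-014 AS res-L0-w41-stub-9, owner of
the sub-stub split; replaces the role of no printed item; NOT a statement of the manuscript under review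
[claim: Hironaka2017, status: under-review]; AI review is weaker than expert review).

The statement is res-L0-w41-idea-2's `Idea2g3.LogFinalExitM` (`Sketch-idea-2c.lean`) with the ZERO-DIMENSIONALITY
binder granted by the holder (r18, 05:00:21Z), every piece of vocabulary (`Concl`, `IsFracOf`, `ZeroDim`,
`LogFinalAt`, `ContentInvertible`, `ToroidalAt`) UNFOLDED verbatim so that the holder closes the registered
stub by `exact logFinalExitM`.

## Assembly (E1 = Frobenius sandwich; E2 = exchanged toroidal radicand)

* E2 (stub-1, p498933): `LogFinal.toroidalExitM`.
* E1: L1 frame at the centre (`ContentFrame.exists_frame_locAtCentre`, p500897) → L3 the ring `B` of common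
  constants is regular local and `S` is free over it of rank `p ^ n` (stub-6, p500081,
  `IteratedSlice.isRegularLocalRing_and_free_of_commuting_slices`) → L3½ `B = S ∩ K^p` (stub-1) → L4 the
  `p`-th-root closure `C = {c | c ^ p ∈ S}` of `S` in `K` is regular local and contains every `S`-integral element
  (stub-3, p501175, `Sandwich.sandwichModel_of_isFractionRing_adjoin`) → MODEL step (lead-1, p500853,
  `IntegralClosureModel.concl_of_pthRootClosure`); the `p`-degree `[K : K^p] = p ^ (n + 1)` consumed by L3½
  (stub-1, p501888, `ConstantsPthPowers.mem_iff`) is `finrank_frobenius_eq_pow_of_ringKrullDim_locAtCentre` below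
  (res-D-pv-004's `finrank_frobenius_eq_pow_of_trdeg_eq` + `trdeg = dim` at the maximal centre).

[cite: Matsumura1987, §25, §30] [cite: Kunz1969, Thm. 2.1] [cite: Posva2023, Lemma 2.37] [folklore]
-/

noncomputable section

-- `Summit.<S>.<S>.…` duplicates the summit name by design (single-problem summit).
set_option linter.dupNamespace false
set_option autoImplicit false

namespace Summit.ResolutionOfSingularities.ResolutionOfSingularities.Theorems.SwitchingDichotomy

namespace LogFinal

open IsLocalRing Polynomial
open Literature.AlgebraicGeometry.Resolution
open Literature.RingTheory.Derivation

/-- Elements of `(A₁)_{𝔪_O ∩ A₁} ⊆ K` are fractions of elements of `A₀` when the elements of `A₁` are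
(bookkeeping for the `p`-th-power step). [folklore] -/
theorem exists_div_eq_of_mem_locAtCentre {k K : Type} [Field k] [Field K] [Algebra k K]
    (O : ValuationSubring K) (A₀ A₁ : Subalgebra k K)
    (hfrac : ∀ x ∈ A₁, ∃ y ∈ A₀, ∃ z ∈ A₀, z ≠ 0 ∧ x = y / z) {x : K}
    (hx : x ∈ locAtCentre A₁.toSubring O) : ∃ y ∈ A₀, ∃ z ∈ A₀, z ≠ 0 ∧ x = y / z := by
  obtain ⟨a, ha, c, hc, hvc, rfl⟩ := hx
  obtain ⟨y₁, hy₁, z₁, hz₁, hz₁0, rfl⟩ := hfrac a ha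
  obtain ⟨y₂, hy₂, z₂, hz₂, hz₂0, h₂⟩ := hfrac c hc
  have hc0 : (c : K) ≠ 0 := ne_zero_of_valuation_eq_one hvc
  have hy₂0 : y₂ ≠ 0 := by
    rintro rfl
    rw [zero_div] at h₂
    exact hc0 h₂
  refine ⟨y₁ * z₂, A₀.mul_mem hy₁ hz₂, z₁ * y₂, A₀.mul_mem hz₁ hy₂, mul_ne_zero hz₁0 hy₂0, ?_⟩
  rw [h₂]
  field_simp

/-- **The `p`-degree of `K` from the dimension at the centre**: `[K : K^p] = p ^ (n + 1)` when
`K = Frac (A₀[t])`, `t ^ p ∈ A₀ ≤ A₁ ⊆ O` finitely generated, `O` zero-dimensional over the perfect `k`, and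
`dim (A₁)_{𝔪_O ∩ A₁} = n + 1` — `trdeg_k K = trdeg_k A₀[t] = dim A₀[t] = dim A₀ = trdeg_k A₀ ≤ trdeg_k A₁
≤ trdeg_k K` (Matsumura Thm. 5.6, integrality of `A₀[t]` over `A₀`), `trdeg_k A₁ = dim A₁ = dim (A₁)_𝔪`
at the MAXIMAL centre (zero-dimensionality; equidimensionality of affine domains), and
`[K : K^p] = p ^ trdeg` (res-D-pv-004's `finrank_frobenius_eq_pow_of_trdeg_eq`, Matsumura Thm. 26.5).
[cite: Matsumura1987, Thm. 5.6, Thm. 26.5] [folklore] -/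
theorem finrank_frobenius_eq_pow_of_ringKrullDim_locAtCentre {k K : Type} [Field k] [Field K]
    [Algebra k K] (p : ℕ) [Fact p.Prime] [CharP k p] [CharP K p] [PerfectField k]
    (O : ValuationSubring K) (A₀ A₁ : Subalgebra k K) (t : K) (hle : A₀ ≤ A₁)
    (hfg₀ : A₀.FG) (hfg₁ : A₁.FG) (htp : t ^ p ∈ A₀)
    (hfr : IsFractionRing (Algebra.adjoin k (insert t (A₀ : Set K))) K)
    (h₁ : A₁.toSubring ≤ O.toSubring)
    (hzd : ∀ x ∈ O, ∃ g : k[X], g ≠ 0 ∧ aeval x g ∈ O.nonunits) {n : ℕ}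
    (hdim : ringKrullDim (locAtCentre A₁.toSubring O) = ((n + 1 : ℕ) : WithBot ℕ∞)) :
    Module.finrank (frobenius K p).fieldRange K = p ^ (n + 1) := by
  classical
  -- `R := A₀[t]`, a finitely generated domain with `Frac R = K`
  set R : Subalgebra k K := Algebra.adjoin k (insert t (A₀ : Set K)) with hR
  have hRfg : R.FG := by
    obtain ⟨s, hs⟩ := hfg₀
    rw [hR, ← hs, Algebra.adjoin_insert_adjoin, ← Finset.coe_insert]
    exact Subalgebra.fg_adjoin_finset _
  haveI : Algebra.FiniteType k R := (Subalgebra.fg_iff_finiteType R).mp hRfg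
  haveI : Algebra.FiniteType k A₀ := (Subalgebra.fg_iff_finiteType A₀).mp hfg₀
  haveI : Algebra.FiniteType k A₁ := (Subalgebra.fg_iff_finiteType A₁).mp hfg₁
  haveI := hfr
  haveI : Algebra.EssFiniteType R K := Algebra.EssFiniteType.of_isLocalization K (nonZeroDivisors R)
  haveI : Algebra.EssFiniteType k K := Algebra.EssFiniteType.comp k R K
  -- the dimensions / transcendence degrees of the three affine domains
  obtain ⟨mR, hdimR, htrR⟩ := exists_ringKrullDim_eq_and_trdeg_eq k R
  obtain ⟨m₀, hdim₀, htr₀⟩ := exists_ringKrullDim_eq_and_trdeg_eq k A₀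
  obtain ⟨m₁, hdim₁, htr₁⟩ := exists_ringKrullDim_eq_and_trdeg_eq k A₁
  -- `trdeg_k K = trdeg_k R`
  have hKR : Algebra.trdeg k K = Algebra.trdeg k R := trdeg_eq_trdeg_of_isFractionRing R
  -- `dim R = dim A₀`: `R = A₀[t]` is integral over `A₀`
  have hA₀R : A₀ ≤ R := fun x hx => Algebra.subset_adjoin (Set.mem_insert_of_mem _ hx)
  have hmR : mR = m₀ := by
    letI : Algebra A₀ R := (Subalgebra.inclusion hA₀R).toRingHom.toAlgebra
    haveI : IsScalarTower A₀ R K := IsScalarTower.of_algebraMap_eq fun _ => rfl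
    have hinj : Function.Injective (algebraMap A₀ R) := Subalgebra.inclusion_injective hA₀R
    haveI : Algebra.IsIntegral A₀ R := by
      refine ⟨fun x => ?_⟩
      have hxK : IsIntegral A₀ (x : K) := by
        have hsub : (R : Set K) ⊆ (integralClosure A₀ K).restrictScalars k := by
          rw [hR]
          refine Algebra.adjoin_le ?_
          rintro y (hy | hy)
          · refine IsIntegral.of_pow (Fact.out : p.Prime).pos ?_
            rw [hy]
            exact isIntegral_algebraMap (R := A₀) (A := K) (x := ⟨t ^ p, htp⟩)
          · exact isIntegral_algebraMap (R := A₀) (A := K) (x := ⟨y, hy⟩)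
        exact hsub x.2
      exact (isIntegral_algHom_iff (IsScalarTower.toAlgHom A₀ R K) Subtype.val_injective).mp hxK
    have h := ringKrullDim_eq_of_isIntegral (R := A₀) (S := R) hinj
    rw [hdimR, hdim₀] at h
    exact_mod_cast h
  -- `dim A₁ = n + 1`: the centre is maximal (zero-dimensionality), equidimensionality of affine domains
  have hm₁ : m₁ = n + 1 := by
    letI : Algebra k A₁.toSubring := A₁.algebra
    haveI : Algebra.FiniteType k A₁.toSubring := (Subalgebra.fg_iff_finiteType A₁).mp hfg₁
    haveI hmax : (subringCentre A₁.toSubring O h₁).IsMaximal := PfaffLine.isMaximal_centre_of_zeroDim O hzd A₁ h₁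
    have h := ringKrullDim_localization_atPrime_eq_of_isMaximal k (subringCentre A₁.toSubring O h₁)
    rw [ringKrullDim_eq_of_ringEquiv (locAtCentreEquiv h₁).toRingEquiv, hdim] at h
    have h' : ringKrullDim A₁.toSubring = ringKrullDim A₁ := rfl
    rw [h', hdim₁] at h
    exact_mod_cast h.symm
  -- the chain `trdeg A₀ ≤ trdeg A₁ ≤ trdeg K = trdeg R = trdeg A₀`
  have h01 : Algebra.trdeg k A₀ ≤ Algebra.trdeg k A₁ :=
    trdeg_le_of_injective (Subalgebra.inclusion hle) (Subalgebra.inclusion_injective hle)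
  have h1K : Algebra.trdeg k A₁ ≤ Algebra.trdeg k K :=
    trdeg_le_of_injective A₁.val Subtype.val_injective
  have htrK : Algebra.trdeg k K = (n + 1 : ℕ) := by
    apply le_antisymm
    · rw [hKR, htrR, hmR, ← htr₀]
      exact h01.trans (by rw [htr₁, hm₁])
    · rw [← hm₁, ← htr₁]
      exact h1K
  exact Literature.FieldTheory.Separability.finrank_frobenius_eq_pow_of_trdeg_eq (k := k) p htrK

/-- **`stub_logFinalExitM` (r18/r19): the log-final exit, model form.** `k` perfect of characteristic `p`; a
finitely generated regular model `A₁` of `Frac A₀`, `A₀ ≤ A₁ ⊆ O`, `O` zero-dimensional over `k`, with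
`S := (A₁)_{𝔪_O ∩ A₁}` regular local; if `S` is LOG-FINAL for `t` — E1: the content of `d(t ^ p)` is invertible
in `S`, or E2: some exchanged radicand `t₂ ^ p`, `t₂ ∉ Frac A₀`, is toroidal in `S` with an exponent prime to
`p` — then `(A₀, t)` has a finitely generated regular model inside `O`. Vocabulary unfolded verbatim from the
skeleton r19. [cite: Matsumura1987, §25, §30] [cite: Kunz1969, Thm. 2.1] [cite: Posva2023, Lemma 2.37] [folklore] -/
theorem logFinalExitM (p : ℕ) :
    ∀ (k K : Type) [Field k] [CharP k p] [PerfectField k] [Field K] [Algebra k K]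
      (O : ValuationSubring K) (A₀ A₁ : Subalgebra k K) (h₀ : A₀.toSubring ≤ O.toSubring) (t : K),
      p.Prime → A₀.FG → t ^ p ∈ A₀ → IsFractionRing (Algebra.adjoin k (insert t (A₀ : Set K))) K →
      IsRegularLocalRing
        (Localization.AtPrime (Ideal.comap (Subring.inclusion h₀) (IsLocalRing.maximalIdeal O))) →
      A₀ ≤ A₁ → A₁.FG → (∀ x ∈ A₁, ∃ y ∈ A₀, ∃ z ∈ A₀, z ≠ 0 ∧ x = y / z) →
      A₁.toSubring ≤ O.toSubring →
      (∀ x ∈ O, ∃ f : Polynomial k, f ≠ 0 ∧ Polynomial.aeval x f ∈ O.nonunits) →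
      ∀ (_ : IsLocalRing (locAtCentre A₁.toSubring O)),
        IsRegularLocalRing (locAtCentre A₁.toSubring O) →
        ((∃ f' : locAtCentre A₁.toSubring O, (f' : K) = t ^ p ∧
            ∃ h : locAtCentre A₁.toSubring O, h ≠ 0 ∧
              (∀ δ : Derivation ℤ (locAtCentre A₁.toSubring O) (locAtCentre A₁.toSubring O), h ∣ δ f') ∧
              ∃ (δ : Derivation ℤ (locAtCentre A₁.toSubring O) (locAtCentre A₁.toSubring O))
                (u : locAtCentre A₁.toSubring O), IsUnit u ∧ δ f' = h * u) ∨
          (∃ t₂ : K, ¬ (∃ y ∈ A₀, ∃ z ∈ A₀, z ≠ 0 ∧ t₂ = y / z) ∧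
            ∃ (s : ℕ) (z : Fin s → locAtCentre A₁.toSubring O), IsRsopPart z ∧
              ∃ (m : Fin s → ℕ), (∃ l, ¬ p ∣ m l) ∧
                ∃ u : locAtCentre A₁.toSubring O, IsUnit u ∧
                  t₂ ^ p = (∏ l, ((z l : locAtCentre A₁.toSubring O) : K) ^ m l) * (u : K))) →
        ∃ (A : Subalgebra k K) (h : A.toSubring ≤ O.toSubring), A₀ ≤ A ∧ t ∈ A ∧ A.FG ∧
          IsFractionRing A K ∧ IsRegularLocalRing (Localization.AtPrime
            (Ideal.comap (Subring.inclusion h) (IsLocalRing.maximalIdeal O))) := by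
  intro k K _ _ _ _ _ O A₀ A₁ h₀ t hp hfg₀ htp hfr hreg₀ hle hfg₁ hfrac h₁ hzd _ hregS hlog
  classical
  haveI : Fact p.Prime := ⟨hp⟩
  haveI : CharP K p := charP_of_injective_algebraMap (algebraMap k K).injective p
  haveI : ExpChar K p := ExpChar.prime hp
  rcases hlog with ⟨f', hf', h, hh, hdiv, δ₀, u, hu, hδ₀⟩ | ⟨t₂, ht₂, s, z, hz, m, hm, u, hu, hrel⟩
  · -- ### E1: the Frobenius sandwich
    -- L1 (p500897): the commuting `p`-nilpotent frame at the centre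
    obtain ⟨n, y, D, hy, hdim, hDf, hDy, hcomm, hnil, huniq, ⟨Δ₀, hΔ₀f, hΔ₀y⟩, hdet⟩ :=
      ContentFrame.exists_frame_locAtCentre p O A₁ h₁ hfg₁ hzd hregS f' hh hdiv δ₀ hu hδ₀
    -- the ring of common constants of the frame
    let B : Subring (locAtCentre A₁.toSubring O) :=
      { carrier := {c | ∀ i, D i c = 0}
        mul_mem' := fun {a b} ha hb i => by
          rw [Derivation.leibniz, ha i, hb i, smul_zero, smul_zero, add_zero]
        one_mem' := fun i => Derivation.map_one_eq_zero _
        add_mem' := fun {a b} ha hb i => by rw [map_add, ha i, hb i, add_zero]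
        zero_mem' := fun i => map_zero _
        neg_mem' := fun {a} ha i => by rw [map_neg, ha i, neg_zero] }
    have hB : ∀ c, c ∈ B ↔ ∀ i, D i c = 0 := fun c => Iff.rfl
    -- L3 (p500081): `B` is regular local and `S` is free over `B` of rank `p ^ n`
    haveI : CharP (locAtCentre A₁.toSubring O) p := ContentFrame.charP_locAtCentre p O A₁
    haveI := hregS
    obtain ⟨hregB, hfree, hrank⟩ :=
      IteratedSlice.isRegularLocalRing_and_free_of_commuting_slices p D (fun j => y j.succ) hcomm hnil hDy
        B hB
    have hfB : f' ∈ B := (hB f').mpr hDf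
    -- L3½ (stub-1, p501888): `B = S ∩ K^p`
    have hA₀S' : A₀.toSubring ≤ locAtCentre A₁.toSubring O :=
      fun x hx => le_locAtCentre A₁.toSubring O (hle hx)
    have hf'eq : f' = ⟨t ^ p, hA₀S' htp⟩ := Subtype.ext hf'
    have hdeg : Module.finrank (frobenius K p).fieldRange K = p ^ (n + 1) :=
      finrank_frobenius_eq_pow_of_ringKrullDim_locAtCentre p O A₀ A₁ t hle hfg₀ hfg₁ htp hfr h₁ hzd hdim
    haveI : Module.Finite B (locAtCentre A₁.toSubring O) :=
      Module.finite_of_finrank_pos (by rw [hrank]; exact pow_pos hp.pos n)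
    have hBK : ∀ x : locAtCentre A₁.toSubring O, x ∈ B ↔ ∃ c : K, c ^ p = (x : K) :=
      ConstantsPthPowers.mem_iff p A₀ t htp hfr (locAtCentre A₁.toSubring O) hA₀S'
        (fun x hx => exists_div_eq_of_mem_locAtCentre O A₀ A₁ hfrac hx) D
        (fun i => by rw [← hf'eq]; exact hDf i) ⟨Δ₀, by rw [← hf'eq]; exact hΔ₀f⟩ B hB
        (Module.Free.chooseBasis B (locAtCentre A₁.toSubring O))
        (Module.Free.chooseBasis B (locAtCentre A₁.toSubring O)).linearIndependent
        (by rw [← Module.finrank_eq_card_chooseBasisIndex, hrank]) hdeg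
    -- the subring `B` seen in `K`
    let B' : Subring K := B.map (locAtCentre A₁.toSubring O).subtype
    have hB' : ∀ x : K, x ∈ B' ↔ x ∈ locAtCentre A₁.toSubring O ∧ ∃ c : K, c ^ p = x := by
      intro x
      constructor
      · rintro ⟨b, hb, rfl⟩
        exact ⟨b.2, (hBK b).mp hb⟩
      · rintro ⟨hx, c, hc⟩
        exact ⟨⟨x, hx⟩, (hBK ⟨x, hx⟩).mpr ⟨c, hc⟩, rfl⟩
    haveI hregB' : IsRegularLocalRing B' :=
      IsRegularLocalRing.of_ringEquiv (B.equivMapOfInjective _ Subtype.val_injective)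
    -- L4 (stub-3, p501175): the `p`-th-root closure `C = {c | c ^ p ∈ S}` of `S` in `K` is regular local
    -- and is the integral closure of `S` in `K`
    haveI := hfr
    have hA₀S : (A₀ : Set K) ⊆ locAtCentre A₁.toSubring O :=
      fun x hx => le_locAtCentre A₁.toSubring O (hle hx)
    have htpS : t ^ p ∈ locAtCentre A₁.toSubring O := le_locAtCentre A₁.toSubring O (hle htp)
    obtain ⟨-, hregC, -, hCint, -⟩ := Sandwich.sandwichModel_of_isFractionRing_adjoin p A₀ hA₀S htpS hB'
    have hCp : ∀ x : K, x ∈ (locAtCentre A₁.toSubring O).comap (frobenius K p) ↔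
        x ^ p ∈ locAtCentre A₁.toSubring O := Sandwich.mem_comap_frobenius_iff p _
    have hCi : ∀ x : K, IsIntegral (locAtCentre A₁.toSubring O) x →
        x ∈ (locAtCentre A₁.toSubring O).comap (frobenius K p) := fun x hx => (hCint x).mpr hx
    -- MODEL (p500853)
    exact IntegralClosureModel.concl_of_pthRootClosure O A₀ A₁ h₁ t hp.ne_zero hle hfg₁ htp hfr _ hCp hCi hregC
  · -- ### E2: the exchanged toroidal radicand (stub-1, p498933)
    exact LogFinal.toroidalExitM p k K O A₀ A₁ h₀ t hp hfg₀ htp hfr hle hfg₁ hfrac h₁ t₂ ht₂ s z hz m hm u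
      hu hrel

end LogFinal

end Summit.ResolutionOfSingularities.ResolutionOfSingularities.Theorems.SwitchingDichotomy
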